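import Literature.Barriers.NavierStokesRegularity.ComplexNavierStokesBlowupSeriesModeCriterion
import Literature.Barriers.NavierStokesRegularity.ComplexNavierStokesBlowupSeriesGlobalBounds
import Mathlib.Algebra.Order.BigOperators.Ring.Finset
import Mathlib.Analysis.SpecificLimits.Basic
import HarnessLib

/-!
# Li–Sinai complex Navier–Stokes blow-up: infinite energy ⇔ a positive exponential rate of the modes

Eighth file of the barrier entry `ComplexNavierStokesBlowup` (D-0021), companion of
`ComplexNavierStokesBlowupSeries.lean` (the power series (3) of D. Li, Ya. G. Sinai, *Blow ups of
complex solutions of the 3D Navier–Stokes system and renormalization group method*, J. Eur. Math.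
Soc. 10 (2008) 267–313, §2, PROVED there to solve the integral equation (1) at all times), of
`ComplexNavierStokesBlowupSeriesEnergy.lean` (the named fact `LiSinaiSeriesEnergyInfinite` =
infinite energy of the series solution at one time for one admissible datum — the unproved core
behind the Theorem-1-backed catalogue form `LiSinaiCriticalEnergyBlowupNarrow`), of
`ComplexNavierStokesBlowupSeriesModeCriterion.lean` (the single-mode criterion in measure) and of
`ComplexNavierStokesBlowupSeriesGlobalBounds.lean` (geometric sup bounds of the modes, uniform in
time). Everything in this file is PROVED; no new fact is stated. (Fourier space is
`EuclideanSpace ℝ (Fin 3)`; `k 2` is the third coordinate `k₃`; `mode v₀ p t` is the `p`-th term of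
the series (3)/(46) at time `t`, amplitude absorbed into the datum, so that the series of the datum
`A v₀` is the power series `Σ_p A^p mode v₀ p` in the amplitude, `LiSinai.mode_smul`.)

## What is here (ours; elementary)

The source infers the infinite energy at the critical time from the SIZE of the individual terms
`A^p g_p(k, t)` of the series ("there it takes values `O(p)`. This immediately implies that at `t`
the energy is infinite", §10 p. 312, sizes from Theorem 1 p. 311). This file PROVES that, for the
purpose of the barrier, the whole quantitative content of that inference can be compressed into
one qualitative statement about the `L²` norms `‖mode v₀ n (t, ·)‖₂` of the terms:

* `LiSinaiSeriesEnergyInfinite_iff_modeEnergyRate` (**rate characterisation**):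
  `LiSinaiSeriesEnergyInfinite` holds iff for ONE admissible datum `v₀` (measurable, bounded,
  vanishing off `{a ≤ k₃, |k| ≤ R}` with `a > 0`, incompressible), one time `t > 0` and one
  `L > 0`,
  `Lⁿ ≤ ∫ ‖mode v₀ n (t, k)‖² dk` for infinitely many `n`,
  i.e. iff at some positive time the terms of the explicit series are NOT super-exponentially
  small in `L²` — equivalently, iff the power series (3)/(46) in the amplitude `A` fails, at some
  positive time, to have all its `L²` coefficient norms `‖mode v₀ n (t,·)‖₂^{1/n} → 0`.
* Forward direction `LiSinaiSeriesEnergyInfinite.of_modeEnergyRate`: the modes are bounded by a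
  geometric sequence uniformly in time (`LiSinai.norm_mode_le_geometric_exp`) and the `n`-th one
  vanishes off the ball `B(0, n|R|)` (`LiSinai.mode_support`), so an `L²` lower bound `Lⁿ` forces,
  by Chebyshev's inequality (`LiSinai.ofReal_le_volume_superlevel`), a superlevel set
  `{ρⁿ ≤ ‖mode v₀ n (t, k)‖}` of volume `≥ σⁿ` for explicit `ρ, σ > 0`
  (`LiSinai.exists_modeLowerBound_of_energyRate`); the single-mode criterion
  `LiSinaiSeriesEnergyInfinite.of_modeLowerBound` (Turán–Remez in the amplitude, exponential
  tilt) then applies. Cancellations between terms of different order are irrelevant.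
* Backward direction `LiSinai.exists_energyRate_of_energy_eq_top`: at each `k` the series is the
  finite sum `Σ_{p<N} mode v₀ p (t, k)` (`LiSinai.seriesSolution_eq_sum`), and the weighted
  Cauchy–Schwarz inequality `(Σ_p a_p)² ≤ Σ_p 2^{p+1} a_p²` (`Σ_p 2^{-(p+1)} ≤ 1`) with Tonelli
  gives `∫ |v(k,t)|² dk ≤ Σ_p 2^{p+1} ∫ ‖mode v₀ p (t,k)‖² dk`; if the `L²` norms of the modes were
  eventually `≤ 4^{-p}` (which is what the failure of every rate `L > 0` gives for `L = 1/4`) the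
  energy would be finite (`LiSinai.lintegral_enorm_seriesSolution_sq_le_tsum`,
  `LiSinai.lintegral_enorm_mode_sq_lt_top`).

So Theorem 1 of the source (the renormalisation-group asymptotics
`g̃_p = p Z(s) Λ(s)^p e^{-|Y|²/2}(H⁽⁰⁾ + o(1))`, p. 311, with computer-numerical steps §7 p. 295 and
p. 302) enters the Theorem-1-backed part of the barrier ONLY through the statement that the
Duhamel–Taylor coefficients of the explicit all-time solution have a positive exponential `L²`
rate at one positive time for one admissible datum. No such rate is proved here; the energy
PROFILE fact `LiSinaiSeriesEnergyBlowup` (attainment of the first singular time, see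
`ComplexNavierStokesBlowupSeriesSingularTime.lean`) is not touched by this file.

## References

* D. Li, Ya. G. Sinai, J. Eur. Math. Soc. 10 (2008) 267–313: §2 p. 269–270 (eqs. (3)–(6),
  `supp g_p`), §7 p. 295 and p. 302, Thm. 1 p. 311, §10 p. 312 (eq. (46), first paragraph).
  [`LiSinai2008`]
-/

noncomputable section

open MeasureTheory Set Filter Topology Finset
open scoped ENNReal InnerProductSpace RealInnerProductSpace BigOperators

namespace Literature.Barriers.NavierStokesRegularity

namespace LiSinai

/-! ### Chebyshev: an `L²` lower bound on a bounded, boundedly supported field forces a large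
superlevel set -/

/-- **Chebyshev splitting.** If `‖g‖ ≤ B` everywhere and `g` vanishes off the measurable set `S`,
then for every real threshold `ε`,
`∫ ‖g‖² ≤ B² · vol {ε ≤ ‖g‖} + ε² · vol S` (in `ℝ≥0∞`). [folklore] -/
theorem lintegral_enorm_sq_le_of_bound_support
    {g : EuclideanSpace ℝ (Fin 3) → EuclideanSpace ℝ (Fin 3)} (hg : Measurable g)
    {S : Set (EuclideanSpace ℝ (Fin 3))} (hS : MeasurableSet S) (hgS : ∀ k, g k ≠ 0 → k ∈ S)
    {B : ℝ} (ε : ℝ) (hB : ∀ k, ‖g k‖ ≤ B) :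
    ∫⁻ k, ‖g k‖ₑ ^ 2 ≤ ENNReal.ofReal (B ^ 2) * volume {k | ε ≤ ‖g k‖} +
      ENNReal.ofReal (ε ^ 2) * volume S := by
  have hG : MeasurableSet {k : EuclideanSpace ℝ (Fin 3) | ε ≤ ‖g k‖} :=
    measurableSet_le measurable_const hg.norm
  have hpt : ∀ k, ‖g k‖ₑ ^ 2 ≤
      {k : EuclideanSpace ℝ (Fin 3) | ε ≤ ‖g k‖}.indicator (fun _ => ENNReal.ofReal (B ^ 2)) k +
        S.indicator (fun _ => ENNReal.ofReal (ε ^ 2)) k := by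
    intro k
    rw [← ofReal_norm, ← ENNReal.ofReal_pow (norm_nonneg _)]
    by_cases hk : ε ≤ ‖g k‖
    · have hmem : k ∈ {k : EuclideanSpace ℝ (Fin 3) | ε ≤ ‖g k‖} := hk
      rw [Set.indicator_of_mem hmem]
      refine le_add_right (ENNReal.ofReal_le_ofReal ?_)
      exact pow_le_pow_left₀ (norm_nonneg _) (hB k) 2
    · by_cases hz : g k = 0
      · simp [hz]
      · rw [Set.indicator_of_mem (hgS k hz)]
        refine le_add_left (ENNReal.ofReal_le_ofReal ?_)
        exact pow_le_pow_left₀ (norm_nonneg _) (not_le.1 hk).le 2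
  calc ∫⁻ k, ‖g k‖ₑ ^ 2
      ≤ ∫⁻ k, ({k : EuclideanSpace ℝ (Fin 3) | ε ≤ ‖g k‖}.indicator
            (fun _ => ENNReal.ofReal (B ^ 2)) k +
          S.indicator (fun _ => ENNReal.ofReal (ε ^ 2)) k) := lintegral_mono hpt
    _ = (∫⁻ k, {k : EuclideanSpace ℝ (Fin 3) | ε ≤ ‖g k‖}.indicator
            (fun _ => ENNReal.ofReal (B ^ 2)) k) +
          ∫⁻ k, S.indicator (fun _ => ENNReal.ofReal (ε ^ 2)) k :=
        lintegral_add_left (measurable_const.indicator hG) _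
    _ = ENNReal.ofReal (B ^ 2) * volume {k | ε ≤ ‖g k‖} + ENNReal.ofReal (ε ^ 2) * volume S := by
        rw [lintegral_indicator_const hG, lintegral_indicator_const hS]

/-- **Chebyshev lower bound for the superlevel set.** In the situation of
`lintegral_enorm_sq_le_of_bound_support` with `B > 0`: if `Λ ≤ ∫ ‖g‖²` and the threshold `ε` is so
small that `ε² vol S ≤ Λ/2`, then `vol {ε ≤ ‖g‖} ≥ Λ/(2B²)`. [folklore] -/
theorem ofReal_le_volume_superlevel {g : EuclideanSpace ℝ (Fin 3) → EuclideanSpace ℝ (Fin 3)}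
    (hg : Measurable g) {S : Set (EuclideanSpace ℝ (Fin 3))} (hS : MeasurableSet S)
    (hgS : ∀ k, g k ≠ 0 → k ∈ S) {B ε Λ : ℝ} (hB : ∀ k, ‖g k‖ ≤ B)
    (hB0 : 0 < B) (hΛ : 0 ≤ Λ) (hlow : ENNReal.ofReal Λ ≤ ∫⁻ k, ‖g k‖ₑ ^ 2)
    (hsmall : ENNReal.ofReal (ε ^ 2) * volume S ≤ ENNReal.ofReal (Λ / 2)) :
    ENNReal.ofReal (Λ / (2 * B ^ 2)) ≤ volume {k | ε ≤ ‖g k‖} := by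
  have hsplit := lintegral_enorm_sq_le_of_bound_support hg hS hgS ε hB
  have hΛ2 : ENNReal.ofReal Λ = ENNReal.ofReal (Λ / 2) + ENNReal.ofReal (Λ / 2) := by
    rw [← ENNReal.ofReal_add (by positivity) (by positivity)]; congr 1; ring
  have h1 : ENNReal.ofReal (Λ / 2) + ENNReal.ofReal (Λ / 2) ≤
      ENNReal.ofReal (B ^ 2) * volume {k | ε ≤ ‖g k‖} + ENNReal.ofReal (Λ / 2) :=
    (hΛ2 ▸ hlow).trans (hsplit.trans (add_le_add le_rfl hsmall))
  have h2 : ENNReal.ofReal (Λ / 2) ≤ ENNReal.ofReal (B ^ 2) * volume {k | ε ≤ ‖g k‖} :=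
    (ENNReal.add_le_add_iff_right ENNReal.ofReal_ne_top).1 h1
  have hB2 : 0 < B ^ 2 := by positivity
  rw [show Λ / (2 * B ^ 2) = Λ / 2 / B ^ 2 by ring, ENNReal.ofReal_div_of_pos hB2]
  exact ENNReal.div_le_of_le_mul (by rwa [mul_comm] at h2)

/-! ### Application to the modes of the series -/

/-- `n³ ≤ 8ⁿ` for every natural `n` (from `n < 2ⁿ`). [folklore] -/
theorem cube_le_eight_pow (n : ℕ) : (n : ℝ) ^ 3 ≤ (8 : ℝ) ^ n := by
  have h : (n : ℝ) ≤ (2 : ℝ) ^ n := by exact_mod_cast (Nat.lt_two_pow_self).le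
  calc (n : ℝ) ^ 3 ≤ ((2 : ℝ) ^ n) ^ 3 := pow_le_pow_left₀ (Nat.cast_nonneg n) h 3
    _ = (8 : ℝ) ^ n := by rw [← pow_mul, mul_comm, pow_mul]; norm_num

/-- **A uniform geometric sup bound of all modes at a fixed time.** For a measurable datum bounded
by `M₀`, vanishing off `{a ≤ k₃, |k| ≤ R}` with `a > 0`, and `t ≥ 0`: with
`K₁ = max (4 M₀ vol B(0,R) / a) 1`, every mode satisfies `‖mode v₀ n (t, k)‖ ≤ (M₀ + 1) K₁ⁿ`
(from `norm_mode_le_geometric_exp`, dropping the exponential decay). [folklore] -/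
theorem norm_mode_le_uniformGeometric {v₀ : EuclideanSpace ℝ (Fin 3) → EuclideanSpace ℝ (Fin 3)}
    {a R M₀ : ℝ} (ha : 0 < a) (hv₀m : Measurable v₀) (hv₀ : ∀ k, v₀ k ≠ 0 → a ≤ k 2 ∧ ‖k‖ ≤ R)
    (hM₀ : ∀ k, ‖v₀ k‖ ≤ M₀)
    {t : ℝ} (ht : 0 ≤ t) (n : ℕ) (k : EuclideanSpace ℝ (Fin 3)) :
    ‖mode v₀ n t k‖ ≤ (M₀ + 1) * (max (4 * (M₀ * ballVol R) / a) 1) ^ n := by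
  have hM₀' : 0 ≤ M₀ := (norm_nonneg _).trans (hM₀ 0)
  set K : ℝ := 4 * (M₀ * ballVol R) / a with hK
  have hK0 : 0 ≤ K := by have := ballVol_nonneg R; positivity
  have hK₁ : 1 ≤ max K 1 := le_max_right _ _
  rcases n with _ | m
  · simp [mode_zero]; positivity
  · calc ‖mode v₀ (m + 1) t k‖ ≤ M₀ * K ^ m * Real.exp (-(t * ((m : ℝ) + 1) * a ^ 2)) :=
          norm_mode_le_geometric_exp ha hv₀m hv₀ hM₀ m ht k
      _ ≤ M₀ * K ^ m * 1 := by
          refine mul_le_mul_of_nonneg_left ?_ (by positivity)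
          rw [Real.exp_le_one_iff]
          have : 0 ≤ t * ((m : ℝ) + 1) * a ^ 2 := by positivity
          linarith
      _ ≤ (M₀ + 1) * (max K 1) ^ (m + 1) := by
          rw [mul_one]
          have h1 : K ^ m ≤ (max K 1) ^ m := pow_le_pow_left₀ hK0 (le_max_left _ _) m
          have h2 : (max K 1) ^ m ≤ (max K 1) ^ (m + 1) := pow_le_pow_right₀ hK₁ (Nat.le_succ m)
          have h3 : M₀ ≤ M₀ + 1 := by linarith
          calc M₀ * K ^ m ≤ M₀ * (max K 1) ^ (m + 1) :=
                mul_le_mul_of_nonneg_left (h1.trans h2) hM₀'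
            _ ≤ (M₀ + 1) * (max K 1) ^ (m + 1) :=
                mul_le_mul_of_nonneg_right h3 (by positivity)

/-- **The energy of every single mode is finite** (bounded, vanishing off a ball). [folklore] -/
theorem lintegral_enorm_mode_sq_lt_top {v₀ : EuclideanSpace ℝ (Fin 3) → EuclideanSpace ℝ (Fin 3)}
    {a R M₀ : ℝ} (ha : 0 < a) (hv₀m : Measurable v₀) (hv₀ : ∀ k, v₀ k ≠ 0 → a ≤ k 2 ∧ ‖k‖ ≤ R)
    (hM₀ : ∀ k, ‖v₀ k‖ ≤ M₀)
    {t : ℝ} (ht : 0 ≤ t) (n : ℕ) : ∫⁻ k, ‖mode v₀ n t k‖ₑ ^ 2 < ∞ := by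
  set B : ℝ := (M₀ + 1) * (max (4 * (M₀ * ballVol R) / a) 1) ^ n with hB
  set S : Set (EuclideanSpace ℝ (Fin 3)) :=
    Metric.closedBall (0 : EuclideanSpace ℝ (Fin 3)) ((n : ℝ) * |R|) with hS
  have hgS : ∀ k, mode v₀ n t k ≠ 0 → k ∈ S := by
    intro k hk
    rw [hS, mem_closedBall_zero_iff]
    exact (mode_support hv₀ n t k hk).2.trans
      (mul_le_mul_of_nonneg_left (le_abs_self R) (Nat.cast_nonneg n))
  have hB' := norm_mode_le_uniformGeometric ha hv₀m hv₀ hM₀ ht n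
  have hpt : ∀ k, ‖mode v₀ n t k‖ₑ ^ 2 ≤ S.indicator (fun _ => ENNReal.ofReal (B ^ 2)) k := by
    intro k
    by_cases hk : mode v₀ n t k = 0
    · simp [hk]
    · rw [Set.indicator_of_mem (hgS k hk), ← ofReal_norm, ← ENNReal.ofReal_pow (norm_nonneg _)]
      exact ENNReal.ofReal_le_ofReal (pow_le_pow_left₀ (norm_nonneg _) (hB' k) 2)
  calc ∫⁻ k, ‖mode v₀ n t k‖ₑ ^ 2 ≤ ∫⁻ k, S.indicator (fun _ => ENNReal.ofReal (B ^ 2)) k :=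
        lintegral_mono hpt
    _ = ENNReal.ofReal (B ^ 2) * volume S := lintegral_indicator_const measurableSet_closedBall _
    _ < ∞ := ENNReal.mul_lt_top ENNReal.ofReal_lt_top measure_closedBall_lt_top


/-- **From an `L²` rate to the single-mode criterion.** For a measurable datum bounded by `M₀`,
vanishing off `{a ≤ k₃, |k| ≤ R}` with `a > 0`, a time `t ≥ 0` and a rate `L > 0` there are
explicit `ρ, σ > 0` (namely `ρ² = L / (16 (|R|³ vol B(0,1) + 1))`,
`σ = L / (2 (M₀+1)² K₁²)`, `K₁ = max (4 M₀ vol B(0,R)/a) 1`) such that for every `n ≥ 1`: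
if `Lⁿ ≤ ∫ ‖mode v₀ n (t,k)‖² dk` then `vol {k : ρⁿ ≤ ‖mode v₀ n (t,k)‖} ≥ σⁿ`. Chebyshev
(`ofReal_le_volume_superlevel`) with the sup bound `(M₀+1) K₁ⁿ` (`norm_mode_le_uniformGeometric`),
the support ball `B(0, n|R|)` of volume `n³ |R|³ vol B(0,1)` (`mode_support`,
`ballVol_eq_pow_mul`), the threshold `εₙ² = Lⁿ / (2 (n³|R|³ vol B(0,1) + 1))`, and `n³ ≤ 8ⁿ`.
[folklore] -/
theorem exists_modeLowerBound_of_energyRate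
    {v₀ : EuclideanSpace ℝ (Fin 3) → EuclideanSpace ℝ (Fin 3)}
    {a R M₀ : ℝ} (ha : 0 < a) (hv₀m : Measurable v₀) (hv₀ : ∀ k, v₀ k ≠ 0 → a ≤ k 2 ∧ ‖k‖ ≤ R)
    (hM₀ : ∀ k, ‖v₀ k‖ ≤ M₀)
    {t : ℝ} (ht : 0 ≤ t) {L : ℝ} (hL : 0 < L) :
    ∃ ρ σ : ℝ, 0 < ρ ∧ 0 < σ ∧ ∀ n : ℕ, 1 ≤ n →
      ENNReal.ofReal (L ^ n) ≤ ∫⁻ k, ‖mode v₀ n t k‖ₑ ^ 2 →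
        ENNReal.ofReal (σ ^ n) ≤
          volume {k : EuclideanSpace ℝ (Fin 3) | ρ ^ n ≤ ‖mode v₀ n t k‖} := by
  have hM₀' : 0 ≤ M₀ := (norm_nonneg _).trans (hM₀ 0)
  set K₁ : ℝ := max (4 * (M₀ * ballVol R) / a) 1 with hK₁
  have hK₁1 : 1 ≤ K₁ := le_max_right _ _
  have hK₁0 : 0 < K₁ := one_pos.trans_le hK₁1
  set b : ℝ := |R| ^ 3 * ballVol 1 with hb
  have hb0 : 0 ≤ b := by have := ballVol_nonneg 1; positivity
  set c : ℝ := L / (16 * (b + 1)) with hc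
  have hc0 : 0 < c := by positivity
  set σ : ℝ := L / (2 * (M₀ + 1) ^ 2 * K₁ ^ 2) with hσ
  have hσ0 : 0 < σ := by positivity
  refine ⟨Real.sqrt c, σ, Real.sqrt_pos.2 hc0, hσ0, fun n hn hlow => ?_⟩
  have h2n : (2 : ℝ) ≤ 2 ^ n := by
    calc (2 : ℝ) = 2 ^ 1 := (pow_one _).symm
      _ ≤ 2 ^ n := pow_le_pow_right₀ (by norm_num) hn
  -- the data of the Chebyshev bound for the `n`-th mode
  set g : EuclideanSpace ℝ (Fin 3) → EuclideanSpace ℝ (Fin 3) := mode v₀ n t with hg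
  set B : ℝ := (M₀ + 1) * K₁ ^ n with hB
  have hB0 : 0 < B := by positivity
  have hBg : ∀ k, ‖g k‖ ≤ B := norm_mode_le_uniformGeometric ha hv₀m hv₀ hM₀ ht n
  set S : Set (EuclideanSpace ℝ (Fin 3)) :=
    Metric.closedBall (0 : EuclideanSpace ℝ (Fin 3)) ((n : ℝ) * |R|) with hS
  have hgS : ∀ k, g k ≠ 0 → k ∈ S := fun k hk => by
    rw [hS, mem_closedBall_zero_iff]
    exact (mode_support hv₀ n t k hk).2.trans
      (mul_le_mul_of_nonneg_left (le_abs_self R) (Nat.cast_nonneg n))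
  set V : ℝ := (n : ℝ) ^ 3 * b with hV
  have hV0 : 0 ≤ V := by positivity
  have hvolS : volume S = ENNReal.ofReal V := by
    rw [hS, volume_closedBall_eq_ofReal_ballVol, ballVol_eq_pow_mul (by positivity), hV, hb]
    congr 1; ring
  -- the threshold `εₙ`
  set e2 : ℝ := L ^ n / (2 * (V + 1)) with he2
  have he2_0 : 0 ≤ e2 := by positivity
  set ε : ℝ := Real.sqrt e2 with hε
  have hε2 : ε ^ 2 = e2 := Real.sq_sqrt he2_0
  have hLn : 0 ≤ L ^ n := by positivity
  have hsmall : ENNReal.ofReal (ε ^ 2) * volume S ≤ ENNReal.ofReal (L ^ n / 2) := by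
    rw [hε2, hvolS, ← ENNReal.ofReal_mul he2_0]
    refine ENNReal.ofReal_le_ofReal ?_
    rw [he2, div_mul_eq_mul_div, div_le_iff₀ (by positivity : (0 : ℝ) < 2 * (V + 1))]
    nlinarith
  have hcheb := ofReal_le_volume_superlevel (measurable_mode_slice hv₀m n t)
    measurableSet_closedBall hgS hBg hB0 hLn hlow hsmall
  -- compare thresholds: `√c ^ n ≤ εₙ`
  have hρε : Real.sqrt c ^ n ≤ ε := by
    have h1 : (Real.sqrt c ^ n) ^ 2 = c ^ n := by
      rw [← pow_mul, mul_comm, pow_mul, Real.sq_sqrt hc0.le]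
    have h2 : c ^ n ≤ e2 := by
      have h8 : (n : ℝ) ^ 3 ≤ (8 : ℝ) ^ n := cube_le_eight_pow n
      have h81 : (1 : ℝ) ≤ 8 ^ n := one_le_pow₀ (by norm_num)
      have hVle : V + 1 ≤ (8 : ℝ) ^ n * (b + 1) := by
        rw [hV]; nlinarith [mul_le_mul_of_nonneg_right h8 hb0]
      have hbpow : b + 1 ≤ (b + 1) ^ n := le_self_pow₀ (by linarith) (by omega)
      have key : 2 * (V + 1) ≤ (16 : ℝ) ^ n * (b + 1) ^ n := by
        calc 2 * (V + 1) ≤ 2 * ((8 : ℝ) ^ n * (b + 1)) := by nlinarith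
          _ ≤ (2 : ℝ) ^ n * ((8 : ℝ) ^ n * (b + 1) ^ n) := by
              refine mul_le_mul h2n ?_ (by positivity) (by positivity)
              exact mul_le_mul_of_nonneg_left hbpow (by positivity)
          _ = (16 : ℝ) ^ n * (b + 1) ^ n := by
              rw [← mul_assoc, ← mul_pow]; norm_num
      rw [he2, le_div_iff₀ (by positivity : (0 : ℝ) < 2 * (V + 1)), hc, div_pow, mul_pow,
        div_mul_eq_mul_div, div_le_iff₀ (by positivity)]
      exact mul_le_mul_of_nonneg_left key hLn
    have h3 : Real.sqrt c ^ n = Real.sqrt ((Real.sqrt c ^ n) ^ 2) :=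
      (Real.sqrt_sq (pow_nonneg (Real.sqrt_nonneg c) n)).symm
    rw [h3, h1, hε]
    exact Real.sqrt_le_sqrt h2
  -- compare volumes: `σ ^ n ≤ Lⁿ / (2 Bₙ²)`
  have hσle : σ ^ n ≤ L ^ n / (2 * B ^ 2) := by
    rw [hσ, div_pow, hB]
    refine div_le_div_of_nonneg_left hLn (by positivity) ?_
    have hM1 : (M₀ + 1) ^ 2 ≤ ((M₀ + 1) ^ 2) ^ n := le_self_pow₀ (by nlinarith) (by omega)
    calc 2 * ((M₀ + 1) * K₁ ^ n) ^ 2 = 2 * (M₀ + 1) ^ 2 * (K₁ ^ 2) ^ n := by ring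
      _ ≤ 2 ^ n * ((M₀ + 1) ^ 2) ^ n * (K₁ ^ 2) ^ n := by
          refine mul_le_mul_of_nonneg_right ?_ (by positivity)
          exact mul_le_mul h2n hM1 (by positivity) (by positivity)
      _ = (2 * (M₀ + 1) ^ 2 * K₁ ^ 2) ^ n := by rw [mul_pow, mul_pow]
  calc ENNReal.ofReal (σ ^ n) ≤ ENNReal.ofReal (L ^ n / (2 * B ^ 2)) :=
        ENNReal.ofReal_le_ofReal hσle
    _ ≤ volume {k : EuclideanSpace ℝ (Fin 3) | ε ≤ ‖g k‖} := hcheb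
    _ ≤ volume {k : EuclideanSpace ℝ (Fin 3) | Real.sqrt c ^ n ≤ ‖mode v₀ n t k‖} :=
        measure_mono fun k (hk : ε ≤ ‖g k‖) => hρε.trans hk

end LiSinai

open LiSinai

/-- **`L²`-rate criterion for the core fact** (a sign-free, size-only form of the first inference
of §10 of the source, "`A^p g_p(k,t)` … takes values `O(p)`. This immediately implies that at `t`
the energy is infinite"). If ONE admissible datum `v₀` (measurable, bounded, vanishing off
`{a ≤ k₃, |k| ≤ R}` with `a > 0`, incompressible) has, at one time `t > 0` and for one `L > 0`,
`Lⁿ ≤ ∫ ‖mode v₀ n (t, k)‖² dk` for infinitely many `n` — i.e. the terms of its power series are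
not super-exponentially small in `L²` — then `LiSinaiSeriesEnergyInfinite` holds
(`LiSinai.exists_modeLowerBound_of_energyRate` and the single-mode criterion
`LiSinaiSeriesEnergyInfinite.of_modeLowerBound`; the witness there is a tilted, rescaled datum
`A e^{μ k₃} v₀(k)`). [cite: LiSinai2008, §10 p. 312 (first paragraph) and Thm. 1 p. 311] -/
theorem LiSinaiSeriesEnergyInfinite.of_modeEnergyRate
    (h : ∃ (v₀ : EuclideanSpace ℝ (Fin 3) → EuclideanSpace ℝ (Fin 3)) (a R t L : ℝ),
      0 < a ∧ 0 < t ∧ 0 < L ∧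
      Measurable v₀ ∧ (∃ M : ℝ, ∀ k, ‖v₀ k‖ ≤ M) ∧ (∀ k, v₀ k ≠ 0 → a ≤ k 2 ∧ ‖k‖ ≤ R) ∧
      (∀ k, ⟪v₀ k, k⟫ = 0) ∧
      ∃ᶠ n : ℕ in atTop, ENNReal.ofReal (L ^ n) ≤ ∫⁻ k, ‖mode v₀ n t k‖ₑ ^ 2) :
    LiSinaiSeriesEnergyInfinite := by
  obtain ⟨v₀, a, R, t, L, ha, ht, hL, hm, ⟨M₀, hM₀⟩, hsupp, hdiv, hfreq⟩ := h
  obtain ⟨ρ, σ, hρ, hσ, hmain⟩ := exists_modeLowerBound_of_energyRate ha hm hsupp hM₀ ht.le hL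
  refine LiSinaiSeriesEnergyInfinite.of_modeLowerBound
    ⟨v₀, a, R, t, ρ, σ, ha, ht, hρ, hσ, hm, ⟨M₀, hM₀⟩, hsupp, hdiv, ?_⟩
  exact (hfreq.and_eventually (eventually_ge_atTop 1)).mono fun n hn => hmain n hn.2 hn.1

namespace LiSinai

/-! ### The converse: infinite energy forces a positive `L²` rate of the modes -/

/-- **Weighted Cauchy–Schwarz**: `(Σ_{p<N} a_p)² ≤ Σ_{p<N} 2^{p+1} a_p²` for real `a_p`, from
`a_p = 2^{-(p+1)/2} · 2^{(p+1)/2} a_p` and `Σ_{p<N} 2^{-(p+1)} ≤ 1`. [folklore] -/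
theorem sq_sum_le_sum_two_pow_mul_sq (N : ℕ) (a : ℕ → ℝ) :
    (∑ p ∈ range N, a p) ^ 2 ≤ ∑ p ∈ range N, 2 ^ (p + 1) * a p ^ 2 := by
  have h := sum_sq_le_sum_mul_sum_of_sq_le_mul (range N) (r := a)
    (f := fun p => (1 / 2 : ℝ) ^ (p + 1)) (g := fun p => 2 ^ (p + 1) * a p ^ 2)
    (fun p _ => by positivity) (fun p _ => by positivity)
    (fun p _ => by
      have : (1 / 2 : ℝ) ^ (p + 1) * (2 ^ (p + 1) * a p ^ 2) = a p ^ 2 := by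
        rw [← mul_assoc, ← mul_pow]; norm_num
      rw [this])
  refine h.trans ?_
  have hgeom : ∑ p ∈ range N, (1 / 2 : ℝ) ^ (p + 1) ≤ 1 := by
    have h1 : ∑ p ∈ range N, (1 / 2 : ℝ) ^ (p + 1) =
        (1 / 2) * ∑ p ∈ range N, (1 / 2 : ℝ) ^ p := by
      rw [Finset.mul_sum]
      exact Finset.sum_congr rfl fun p _ => by ring
    rw [h1]
    have h2 : ∑ p ∈ range N, (1 / 2 : ℝ) ^ p ≤ 2 := sum_geometric_two_le N
    linarith
  have hnonneg : 0 ≤ ∑ p ∈ range N, 2 ^ (p + 1) * a p ^ 2 :=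
    Finset.sum_nonneg fun p _ => by positivity
  calc (∑ p ∈ range N, (1 / 2 : ℝ) ^ (p + 1)) * ∑ p ∈ range N, 2 ^ (p + 1) * a p ^ 2
      ≤ 1 * ∑ p ∈ range N, 2 ^ (p + 1) * a p ^ 2 := mul_le_mul_of_nonneg_right hgeom hnonneg
    _ = _ := one_mul _

/-- **Pointwise domination of the series by its weighted modes**: for a datum vanishing off
`{a ≤ k₃, |k| ≤ R}` with `a > 0`, at every `t` and `k`,
`|seriesSolution v₀ (k,t)|² ≤ Σ_p 2^{p+1} ‖mode v₀ p (t,k)‖²` (the series is the finite sum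
`Σ_{p<N} mode v₀ p (t,k)`, `seriesSolution_eq_sum`, and `sq_sum_le_sum_two_pow_mul_sq`).
[folklore] -/
theorem enorm_seriesSolution_sq_le_tsum {v₀ : EuclideanSpace ℝ (Fin 3) → EuclideanSpace ℝ (Fin 3)}
    {a R : ℝ} (ha : 0 < a)
    (hv₀ : ∀ k, v₀ k ≠ 0 → a ≤ k 2 ∧ ‖k‖ ≤ R) (t : ℝ) (k : EuclideanSpace ℝ (Fin 3)) :
    ‖seriesSolution v₀ t k‖ₑ ^ 2 ≤ ∑' p, 2 ^ (p + 1) * ‖mode v₀ p t k‖ₑ ^ 2 := by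
  set N : ℕ := ⌊k 2 / a⌋₊ + 1 with hN
  rw [seriesSolution_eq_sum ha hv₀ (lt_floor_succ_mul ha (k 2)) t]
  have hreal : ‖∑ p ∈ range N, mode v₀ p t k‖ ^ 2 ≤
      ∑ p ∈ range N, 2 ^ (p + 1) * ‖mode v₀ p t k‖ ^ 2 :=
    (pow_le_pow_left₀ (norm_nonneg _) (norm_sum_le _ _) 2).trans
      (sq_sum_le_sum_two_pow_mul_sq N fun p => ‖mode v₀ p t k‖)
  calc ‖∑ p ∈ range N, mode v₀ p t k‖ₑ ^ 2
      = ENNReal.ofReal (‖∑ p ∈ range N, mode v₀ p t k‖ ^ 2) := by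
        rw [← ofReal_norm, ENNReal.ofReal_pow (norm_nonneg _)]
    _ ≤ ENNReal.ofReal (∑ p ∈ range N, 2 ^ (p + 1) * ‖mode v₀ p t k‖ ^ 2) :=
        ENNReal.ofReal_le_ofReal hreal
    _ = ∑ p ∈ range N, 2 ^ (p + 1) * ‖mode v₀ p t k‖ₑ ^ 2 := by
        rw [ENNReal.ofReal_sum_of_nonneg fun p _ => by positivity]
        refine Finset.sum_congr rfl fun p _ => ?_
        rw [ENNReal.ofReal_mul (by positivity), ENNReal.ofReal_pow (by norm_num),
          ENNReal.ofReal_ofNat, ← ofReal_norm, ENNReal.ofReal_pow (norm_nonneg _)]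
    _ ≤ ∑' p, 2 ^ (p + 1) * ‖mode v₀ p t k‖ₑ ^ 2 := ENNReal.sum_le_tsum _

/-- **Energy of the series ≤ weighted sum of the energies of its modes**:
`∫ |seriesSolution v₀ (k,t)|² dk ≤ Σ_p 2^{p+1} ∫ ‖mode v₀ p (t,k)‖² dk` (Tonelli). [folklore] -/
theorem lintegral_enorm_seriesSolution_sq_le_tsum
    {v₀ : EuclideanSpace ℝ (Fin 3) → EuclideanSpace ℝ (Fin 3)} {a R : ℝ} (ha : 0 < a)
    (hv₀m : Measurable v₀) (hv₀ : ∀ k, v₀ k ≠ 0 → a ≤ k 2 ∧ ‖k‖ ≤ R) (t : ℝ) :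
    ∫⁻ k, ‖seriesSolution v₀ t k‖ₑ ^ 2 ≤ ∑' p, 2 ^ (p + 1) * ∫⁻ k, ‖mode v₀ p t k‖ₑ ^ 2 := by
  calc ∫⁻ k, ‖seriesSolution v₀ t k‖ₑ ^ 2
      ≤ ∫⁻ k, ∑' p, 2 ^ (p + 1) * ‖mode v₀ p t k‖ₑ ^ 2 :=
        lintegral_mono fun k => enorm_seriesSolution_sq_le_tsum ha hv₀ t k
    _ = ∑' p, ∫⁻ k, 2 ^ (p + 1) * ‖mode v₀ p t k‖ₑ ^ 2 :=
        lintegral_tsum fun p =>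
          (((measurable_mode_slice hv₀m p t).enorm.pow_const 2).const_mul _).aemeasurable
    _ = ∑' p, 2 ^ (p + 1) * ∫⁻ k, ‖mode v₀ p t k‖ₑ ^ 2 := by
        refine tsum_congr fun p => ?_
        rw [lintegral_const_mul _ ((measurable_mode_slice hv₀m p t).enorm.pow_const 2)]

/-- **Infinite energy forces a positive exponential `L²` rate of the modes.** For a measurable
datum bounded by `M₀`, vanishing off `{a ≤ k₃, |k| ≤ R}` with `a > 0`, and `t ≥ 0`: if the
series solution has infinite energy at `t`, then for some `L > 0` (in fact `L = 1/4`)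
`Lⁿ ≤ ∫ ‖mode v₀ n (t,k)‖² dk` for infinitely many `n`. Otherwise the `L²` energies of the modes
would eventually be `< 4^{-n}`, and `lintegral_enorm_seriesSolution_sq_le_tsum` would bound the
energy by a finite sum of finite mode energies (`lintegral_enorm_mode_sq_lt_top`) plus
`Σ_p 2^{p+1} 4^{-p} < ∞`. [folklore] -/
theorem exists_energyRate_of_energy_eq_top
    {v₀ : EuclideanSpace ℝ (Fin 3) → EuclideanSpace ℝ (Fin 3)}
    {a R M₀ : ℝ} (ha : 0 < a) (hv₀m : Measurable v₀) (hv₀ : ∀ k, v₀ k ≠ 0 → a ≤ k 2 ∧ ‖k‖ ≤ R)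
    (hM₀ : ∀ k, ‖v₀ k‖ ≤ M₀)
    {t : ℝ} (ht : 0 ≤ t) (hinf : ∫⁻ k, ‖seriesSolution v₀ t k‖ₑ ^ 2 = ∞) :
    ∃ L : ℝ, 0 < L ∧
      ∃ᶠ n : ℕ in atTop, ENNReal.ofReal (L ^ n) ≤ ∫⁻ k, ‖mode v₀ n t k‖ₑ ^ 2 := by
  by_contra hcon
  simp only [not_exists, not_and, Filter.not_frequently, not_le] at hcon
  set e : ℕ → ℝ≥0∞ := fun p => ∫⁻ k, ‖mode v₀ p t k‖ₑ ^ 2 with he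
  have hev : ∀ᶠ p : ℕ in atTop, e p ≤ ENNReal.ofReal ((1 / 4 : ℝ) ^ p) :=
    (hcon (1 / 4) (by norm_num)).mono fun p hp => hp.le
  obtain ⟨N₀, hN₀⟩ := eventually_atTop.1 hev
  -- the weighted sum of the mode energies is finite
  have hfin : ∑' p, 2 ^ (p + 1) * e p < ∞ := by
    have hsplit : (fun p => (2 : ℝ≥0∞) ^ (p + 1) * e p) = fun p =>
        (if p < N₀ then 2 ^ (p + 1) * e p else 0) +
          (if N₀ ≤ p then 2 ^ (p + 1) * e p else 0) := by
      funext p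
      by_cases hp : p < N₀
      · simp [hp, not_le.2 hp]
      · simp [hp, not_lt.1 hp]
    rw [hsplit, ENNReal.tsum_add]
    refine ENNReal.add_lt_top.2 ⟨?_, ?_⟩
    · rw [tsum_eq_sum (s := range N₀) (fun p hp => by
        rw [Finset.mem_range] at hp; simp [hp])]
      refine ENNReal.sum_lt_top.2 fun p hp => ?_
      rw [Finset.mem_range] at hp
      simp only [hp, if_true]
      exact ENNReal.mul_lt_top (ENNReal.pow_ne_top ENNReal.ofNat_ne_top).lt_top
        (lintegral_enorm_mode_sq_lt_top ha hv₀m hv₀ hM₀ ht p)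
    · have hterm : ∀ p, (if N₀ ≤ p then (2 : ℝ≥0∞) ^ (p + 1) * e p else 0) ≤
          ENNReal.ofReal (2 * (1 / 2 : ℝ) ^ p) := by
        intro p
        split_ifs with hp
        · have hreal : (2 : ℝ) ^ (p + 1) * (1 / 4 : ℝ) ^ p = 2 * (1 / 2 : ℝ) ^ p := by
            rw [pow_succ, show (1 / 2 : ℝ) = 2 * (1 / 4) by norm_num, mul_pow]; ring
          have h2 : (2 : ℝ≥0∞) ^ (p + 1) = ENNReal.ofReal ((2 : ℝ) ^ (p + 1)) := by
            rw [ENNReal.ofReal_pow (by norm_num), ENNReal.ofReal_ofNat]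
          calc (2 : ℝ≥0∞) ^ (p + 1) * e p ≤ 2 ^ (p + 1) * ENNReal.ofReal ((1 / 4 : ℝ) ^ p) :=
                mul_le_mul' le_rfl (hN₀ p hp)
            _ = ENNReal.ofReal (2 * (1 / 2 : ℝ) ^ p) := by
                rw [h2, ← ENNReal.ofReal_mul (by positivity), hreal]
        · simp
      have hsum : Summable fun p : ℕ => 2 * (1 / 2 : ℝ) ^ p := summable_geometric_two.mul_left 2
      calc ∑' p, (if N₀ ≤ p then (2 : ℝ≥0∞) ^ (p + 1) * e p else 0)
          ≤ ∑' p, ENNReal.ofReal (2 * (1 / 2 : ℝ) ^ p) := ENNReal.tsum_le_tsum hterm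
        _ = ENNReal.ofReal (∑' p, 2 * (1 / 2 : ℝ) ^ p) :=
            (ENNReal.ofReal_tsum_of_nonneg (fun p => by positivity) hsum).symm
        _ < ∞ := ENNReal.ofReal_lt_top
  exact ((lintegral_enorm_seriesSolution_sq_le_tsum ha hv₀m hv₀ t).trans_lt hfin).ne hinf

end LiSinai

/-- **A witness of the core fact has a positive `L²` rate.** From `LiSinaiSeriesEnergyInfinite`
(an admissible datum whose series solution has infinite energy at some `t > 0`) one gets, for the
same datum and time, an `L > 0` with `Lⁿ ≤ ∫ ‖mode v₀ n (t,k)‖² dk` for infinitely many `n`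
(`LiSinai.exists_energyRate_of_energy_eq_top`). [folklore] -/
theorem LiSinaiSeriesEnergyInfinite.exists_modeEnergyRate (h : LiSinaiSeriesEnergyInfinite) :
    ∃ (v₀ : EuclideanSpace ℝ (Fin 3) → EuclideanSpace ℝ (Fin 3)) (a R t L : ℝ),
      0 < a ∧ 0 < t ∧ 0 < L ∧
      Measurable v₀ ∧ (∃ M : ℝ, ∀ k, ‖v₀ k‖ ≤ M) ∧ (∀ k, v₀ k ≠ 0 → a ≤ k 2 ∧ ‖k‖ ≤ R) ∧
      (∀ k, ⟪v₀ k, k⟫ = 0) ∧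
      ∃ᶠ n : ℕ in atTop, ENNReal.ofReal (L ^ n) ≤ ∫⁻ k, ‖mode v₀ n t k‖ₑ ^ 2 := by
  obtain ⟨v₀, a, R, t, ha, ht, hm, ⟨M₀, hM₀⟩, hsupp, hdiv, hinf⟩ := h
  obtain ⟨L, hL, hfreq⟩ := exists_energyRate_of_energy_eq_top ha hm hsupp hM₀ ht.le hinf
  exact ⟨v₀, a, R, t, L, ha, ht, hL, hm, ⟨M₀, hM₀⟩, hsupp, hdiv, hfreq⟩

/-- **Rate characterisation of the core fact.** `LiSinaiSeriesEnergyInfinite` — infinite energy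
of Li–Sinai's power-series solution (3)/(46) at one positive time for one admissible datum, the
Theorem-1-backed core of the barrier `ComplexNavierStokesBlowup` — holds if and only if for one
admissible datum `v₀`, one time `t > 0` and one `L > 0` the terms of the series satisfy
`Lⁿ ≤ ∫ ‖mode v₀ n (t,k)‖² dk` for infinitely many `n`; i.e. iff the power series in the
amplitude has, at some positive time, coefficients whose `L²` norms are not super-exponentially
small. This is exactly what Theorem 1 of the source (`g̃_p = p Z Λ^p e^{-|Y|²/2}(H⁽⁰⁾ + o(1))`,
p. 311, at `A = A_cr(t) = Λ(t)⁻¹`, §10 p. 312) supplies with a specific `L`; no rate is proved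
here. [cite: LiSinai2008, Thm. 1 p. 311 and §10 p. 312 (first paragraph)] -/
theorem LiSinaiSeriesEnergyInfinite_iff_modeEnergyRate :
    LiSinaiSeriesEnergyInfinite ↔
      ∃ (v₀ : EuclideanSpace ℝ (Fin 3) → EuclideanSpace ℝ (Fin 3)) (a R t L : ℝ),
      0 < a ∧ 0 < t ∧ 0 < L ∧
        Measurable v₀ ∧ (∃ M : ℝ, ∀ k, ‖v₀ k‖ ≤ M) ∧ (∀ k, v₀ k ≠ 0 → a ≤ k 2 ∧ ‖k‖ ≤ R) ∧
        (∀ k, ⟪v₀ k, k⟫ = 0) ∧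
        ∃ᶠ n : ℕ in atTop, ENNReal.ofReal (L ^ n) ≤ ∫⁻ k, ‖mode v₀ n t k‖ₑ ^ 2 :=
  ⟨LiSinaiSeriesEnergyInfinite.exists_modeEnergyRate,
    LiSinaiSeriesEnergyInfinite.of_modeEnergyRate⟩

/-- **The `L²`-rate criterion gives the narrowed Li–Sinai statement** of the barrier audit
(`LiSinaiCriticalEnergyBlowupNarrow`: equation (1) on `[0,t]`, finite energy on an initial
interval, infinite energy at `t`), via `LiSinaiSeriesEnergyInfinite.of_modeEnergyRate` and
`LiSinaiSeriesEnergyInfinite.criticalEnergyBlowupNarrow`. [folklore] -/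
theorem LiSinaiCriticalEnergyBlowupNarrow.of_modeEnergyRate
    (h : ∃ (v₀ : EuclideanSpace ℝ (Fin 3) → EuclideanSpace ℝ (Fin 3)) (a R t L : ℝ),
      0 < a ∧ 0 < t ∧ 0 < L ∧
      Measurable v₀ ∧ (∃ M : ℝ, ∀ k, ‖v₀ k‖ ≤ M) ∧ (∀ k, v₀ k ≠ 0 → a ≤ k 2 ∧ ‖k‖ ≤ R) ∧
      (∀ k, ⟪v₀ k, k⟫ = 0) ∧
      ∃ᶠ n : ℕ in atTop, ENNReal.ofReal (L ^ n) ≤ ∫⁻ k, ‖mode v₀ n t k‖ₑ ^ 2) :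
    LiSinaiCriticalEnergyBlowupNarrow :=
  (LiSinaiSeriesEnergyInfinite.of_modeEnergyRate h).criticalEnergyBlowupNarrow


/-! ## The same characterisation with the `L¹` norms of the modes (appended)

Since every mode is bounded by a geometric sequence and vanishes off a ball of radius `n|R|`
(volume `n³|R|³ vol B(0,1) ≤ 8ⁿ(|R|³ vol B(0,1) + 1)`), the `L¹` and `L²` norms of the `n`-th
mode differ by at most geometric factors: `‖·‖₁² ≤ vol · ‖·‖₂²` (Cauchy–Schwarz) and
`‖·‖₂² ≤ ‖·‖_∞ ‖·‖₁`. Hence the rate characterisation also holds with `∫ ‖mode v₀ n (t,k)‖ dk`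
in place of `∫ ‖mode v₀ n (t,k)‖² dk` (`LiSinaiSeriesEnergyInfinite_iff_modeL1Rate`): the
core fact is equivalent to ONE admissible datum having, at one positive time, terms of its
power series whose `L¹` norms — a fortiori whose integrals against one bounded test field —
are not super-exponentially small. -/

namespace LiSinai

/-- **Cauchy–Schwarz for a boundedly supported field**: if `g` is measurable and vanishes off
the measurable set `S`, then `(∫ ‖g‖)² ≤ vol S · ∫ ‖g‖²` (in `ℝ≥0∞`). [folklore] -/
theorem lintegral_enorm_sq_le_volume_mul
    {g : EuclideanSpace ℝ (Fin 3) → EuclideanSpace ℝ (Fin 3)} (hg : Measurable g)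
    {S : Set (EuclideanSpace ℝ (Fin 3))} (hgS : ∀ k, g k ≠ 0 → k ∈ S) :
    (∫⁻ k, ‖g k‖ₑ) ^ 2 ≤ volume S * ∫⁻ k, ‖g k‖ₑ ^ 2 := by
  set μ : Measure (EuclideanSpace ℝ (Fin 3)) := volume.restrict S with hμ
  have hsupp : Function.support (fun k => ‖g k‖ₑ) ⊆ S := by
    intro k hk
    rw [Function.mem_support, ne_eq, enorm_eq_zero] at hk
    exact hgS k hk
  have hset : ∫⁻ k in S, ‖g k‖ₑ = ∫⁻ k, ‖g k‖ₑ := setLIntegral_eq_of_support_subset hsupp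
  have hmeas : AEMeasurable (fun k => ‖g k‖ₑ) μ := hg.enorm.aemeasurable
  have h := ENNReal.lintegral_mul_le_Lp_mul_Lq μ Real.HolderConjugate.two_two hmeas
    (g := fun _ => 1) aemeasurable_const
  simp only [Pi.mul_apply, mul_one, lintegral_const, ENNReal.rpow_two, one_pow, one_mul] at h
  have hvol : μ univ = volume S := by rw [hμ, Measure.restrict_apply_univ]
  rw [hvol] at h
  have hle2 : ∫⁻ k, ‖g k‖ₑ ^ 2 ∂μ ≤ ∫⁻ k, ‖g k‖ₑ ^ 2 := by
    rw [hμ]; exact setLIntegral_le_lintegral S _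
  calc (∫⁻ k, ‖g k‖ₑ) ^ 2 = (∫⁻ k, ‖g k‖ₑ ∂μ) ^ 2 := by rw [hμ, hset]
    _ ≤ ((∫⁻ k, ‖g k‖ₑ ^ 2 ∂μ) ^ (1 / 2 : ℝ) * volume S ^ (1 / 2 : ℝ)) ^ 2 := by gcongr
    _ = volume S * ∫⁻ k, ‖g k‖ₑ ^ 2 ∂μ := by
        rw [← ENNReal.mul_rpow_of_nonneg _ _ (by norm_num : (0 : ℝ) ≤ 1 / 2), ← ENNReal.rpow_two,
          ← ENNReal.rpow_mul]
        norm_num [mul_comm]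
    _ ≤ volume S * ∫⁻ k, ‖g k‖ₑ ^ 2 := mul_le_mul' le_rfl hle2

/-- **An `L¹` rate gives an `L²` rate.** For a measurable datum vanishing off
`{a ≤ k₃, |k| ≤ R}` with `a > 0`, `L > 0` and `n ≥ 1`: if `Lⁿ ≤ ∫ ‖mode v₀ n (t,k)‖ dk` then
`(L² / (8 (|R|³ vol B(0,1) + 1)))ⁿ ≤ ∫ ‖mode v₀ n (t,k)‖² dk` (Cauchy–Schwarz on the support
ball `B(0, n|R|)`, of volume `n³|R|³ vol B(0,1) ≤ 8ⁿ (|R|³ vol B(0,1) + 1)`). [folklore] -/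
theorem energyRate_of_L1Rate {v₀ : EuclideanSpace ℝ (Fin 3) → EuclideanSpace ℝ (Fin 3)}
    {a R : ℝ} (hv₀m : Measurable v₀) (hv₀ : ∀ k, v₀ k ≠ 0 → a ≤ k 2 ∧ ‖k‖ ≤ R)
    (t : ℝ) {L : ℝ} (hL : 0 < L) {n : ℕ} (hn : 1 ≤ n)
    (hlow : ENNReal.ofReal (L ^ n) ≤ ∫⁻ k, ‖mode v₀ n t k‖ₑ) :
    ENNReal.ofReal ((L ^ 2 / (8 * (|R| ^ 3 * ballVol 1 + 1))) ^ n) ≤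
      ∫⁻ k, ‖mode v₀ n t k‖ₑ ^ 2 := by
  set b : ℝ := |R| ^ 3 * ballVol 1 with hb
  have hb0 : 0 ≤ b := by have := ballVol_nonneg 1; positivity
  set S : Set (EuclideanSpace ℝ (Fin 3)) :=
    Metric.closedBall (0 : EuclideanSpace ℝ (Fin 3)) ((n : ℝ) * |R|) with hS
  have hgS : ∀ k, mode v₀ n t k ≠ 0 → k ∈ S := fun k hk => by
    rw [hS, mem_closedBall_zero_iff]
    exact (mode_support hv₀ n t k hk).2.trans
      (mul_le_mul_of_nonneg_left (le_abs_self R) (Nat.cast_nonneg n))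
  set V : ℝ := (n : ℝ) ^ 3 * b with hV
  have hvolS : volume S = ENNReal.ofReal V := by
    rw [hS, volume_closedBall_eq_ofReal_ballVol, ballVol_eq_pow_mul (by positivity), hV, hb]
    congr 1; ring
  set D : ℝ := (8 : ℝ) ^ n * (b + 1) with hD
  have hD0 : 0 < D := by positivity
  have hVD : V ≤ D := by
    have h8 : (n : ℝ) ^ 3 ≤ (8 : ℝ) ^ n := cube_le_eight_pow n
    have h81 : (1 : ℝ) ≤ 8 ^ n := one_le_pow₀ (by norm_num)
    rw [hV, hD]; nlinarith [mul_le_mul_of_nonneg_right h8 hb0]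
  set E₂ : ℝ≥0∞ := ∫⁻ k, ‖mode v₀ n t k‖ₑ ^ 2 with hE₂
  have hCS := lintegral_enorm_sq_le_volume_mul (measurable_mode_slice hv₀m n t) hgS
  have h1 : ENNReal.ofReal ((L ^ n) ^ 2) ≤ ENNReal.ofReal D * E₂ := by
    calc ENNReal.ofReal ((L ^ n) ^ 2) = ENNReal.ofReal (L ^ n) ^ 2 :=
          ENNReal.ofReal_pow (by positivity) 2
      _ ≤ (∫⁻ k, ‖mode v₀ n t k‖ₑ) ^ 2 := by gcongr
      _ ≤ volume S * E₂ := hCS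
      _ ≤ ENNReal.ofReal D * E₂ := by
          rw [hvolS]; exact mul_le_mul' (ENNReal.ofReal_le_ofReal hVD) le_rfl
  -- `cⁿ · D ≤ (Lⁿ)²` for `c = L² / (8 (b + 1))`
  set c : ℝ := L ^ 2 / (8 * (b + 1)) with hc
  have hc0 : 0 ≤ c := by positivity
  have hcD : c ^ n * D ≤ (L ^ n) ^ 2 := by
    have hbpow : b + 1 ≤ (b + 1) ^ n := le_self_pow₀ (by linarith) (by omega)
    have hexp : c ^ n * D = (L ^ n) ^ 2 * ((b + 1) / (b + 1) ^ n) := by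
      rw [hc, hD, div_pow, mul_pow, ← pow_mul, ← pow_mul]
      have h8n : (8 : ℝ) ^ n ≠ 0 := pow_ne_zero n (by norm_num)
      have hb1n : (b + 1) ^ n ≠ 0 := pow_ne_zero n (by linarith)
      field_simp
      ring
    rw [hexp]
    have hfrac : (b + 1) / (b + 1) ^ n ≤ 1 := (div_le_one (by positivity)).2 hbpow
    calc (L ^ n) ^ 2 * ((b + 1) / (b + 1) ^ n) ≤ (L ^ n) ^ 2 * 1 :=
          mul_le_mul_of_nonneg_left hfrac (by positivity)
      _ = (L ^ n) ^ 2 := mul_one _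
  have h2 : ENNReal.ofReal (c ^ n) * ENNReal.ofReal D ≤ E₂ * ENNReal.ofReal D := by
    calc ENNReal.ofReal (c ^ n) * ENNReal.ofReal D = ENNReal.ofReal (c ^ n * D) :=
          (ENNReal.ofReal_mul (by positivity)).symm
      _ ≤ ENNReal.ofReal ((L ^ n) ^ 2) := ENNReal.ofReal_le_ofReal hcD
      _ ≤ ENNReal.ofReal D * E₂ := h1
      _ = E₂ * ENNReal.ofReal D := mul_comm _ _
  exact (ENNReal.mul_le_mul_iff_left ((ENNReal.ofReal_pos.2 hD0).ne') ENNReal.ofReal_ne_top).1 h2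

/-- **An `L²` rate gives an `L¹` rate.** For a measurable datum bounded by `M₀`, vanishing off
`{a ≤ k₃, |k| ≤ R}` with `a > 0`, `t ≥ 0`, `L > 0` and `n ≥ 1`: if `Lⁿ ≤ ∫ ‖mode v₀ n (t,k)‖² dk`
then `(L / ((M₀+1) K₁))ⁿ ≤ ∫ ‖mode v₀ n (t,k)‖ dk`, `K₁ = max (4 M₀ vol B(0,R)/a) 1`
(`‖·‖₂² ≤ ‖·‖_∞ ‖·‖₁` with the sup bound `norm_mode_le_uniformGeometric`). [folklore] -/
theorem L1Rate_of_energyRate {v₀ : EuclideanSpace ℝ (Fin 3) → EuclideanSpace ℝ (Fin 3)}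
    {a R M₀ : ℝ} (ha : 0 < a) (hv₀m : Measurable v₀) (hv₀ : ∀ k, v₀ k ≠ 0 → a ≤ k 2 ∧ ‖k‖ ≤ R)
    (hM₀ : ∀ k, ‖v₀ k‖ ≤ M₀) {t : ℝ} (ht : 0 ≤ t) {L : ℝ} (hL : 0 < L) {n : ℕ} (hn : 1 ≤ n)
    (hlow : ENNReal.ofReal (L ^ n) ≤ ∫⁻ k, ‖mode v₀ n t k‖ₑ ^ 2) :
    ENNReal.ofReal ((L / ((M₀ + 1) * max (4 * (M₀ * ballVol R) / a) 1)) ^ n) ≤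
      ∫⁻ k, ‖mode v₀ n t k‖ₑ := by
  have hM₀' : 0 ≤ M₀ := (norm_nonneg _).trans (hM₀ 0)
  set K₁ : ℝ := max (4 * (M₀ * ballVol R) / a) 1 with hK₁
  have hK₁1 : 1 ≤ K₁ := le_max_right _ _
  set B : ℝ := (M₀ + 1) * K₁ ^ n with hB
  have hB0 : 0 < B := by positivity
  have hBg : ∀ k, ‖mode v₀ n t k‖ ≤ B := norm_mode_le_uniformGeometric ha hv₀m hv₀ hM₀ ht n
  set E₁ : ℝ≥0∞ := ∫⁻ k, ‖mode v₀ n t k‖ₑ with hE₁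
  -- `∫ ‖g‖² ≤ B ∫ ‖g‖`
  have h1 : ∫⁻ k, ‖mode v₀ n t k‖ₑ ^ 2 ≤ ENNReal.ofReal B * E₁ := by
    calc ∫⁻ k, ‖mode v₀ n t k‖ₑ ^ 2 ≤ ∫⁻ k, ENNReal.ofReal B * ‖mode v₀ n t k‖ₑ := by
          refine lintegral_mono fun k => ?_
          rw [sq]
          refine mul_le_mul' ?_ le_rfl
          rw [← ofReal_norm]
          exact ENNReal.ofReal_le_ofReal (hBg k)
      _ = ENNReal.ofReal B * E₁ :=
          lintegral_const_mul _ (measurable_mode_slice hv₀m n t).enorm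
  -- `cⁿ · B ≤ Lⁿ` for `c = L / ((M₀+1) K₁)`
  set c : ℝ := L / ((M₀ + 1) * K₁) with hc
  have hcB : c ^ n * B ≤ L ^ n := by
    have hM1 : M₀ + 1 ≤ (M₀ + 1) ^ n := le_self_pow₀ (by linarith) (by omega)
    have hexp : c ^ n * B = L ^ n * ((M₀ + 1) / (M₀ + 1) ^ n) := by
      rw [hc, hB, div_pow, mul_pow]
      have hK : K₁ ^ n ≠ 0 := pow_ne_zero n (by positivity)
      have hM : (M₀ + 1) ^ n ≠ 0 := pow_ne_zero n (by positivity)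
      field_simp
    rw [hexp]
    have hfrac : (M₀ + 1) / (M₀ + 1) ^ n ≤ 1 := (div_le_one (by positivity)).2 hM1
    calc L ^ n * ((M₀ + 1) / (M₀ + 1) ^ n) ≤ L ^ n * 1 :=
          mul_le_mul_of_nonneg_left hfrac (by positivity)
      _ = L ^ n := mul_one _
  have h2 : ENNReal.ofReal (c ^ n) * ENNReal.ofReal B ≤ E₁ * ENNReal.ofReal B := by
    calc ENNReal.ofReal (c ^ n) * ENNReal.ofReal B = ENNReal.ofReal (c ^ n * B) :=
          (ENNReal.ofReal_mul (by positivity)).symm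
      _ ≤ ENNReal.ofReal (L ^ n) := ENNReal.ofReal_le_ofReal hcB
      _ ≤ ENNReal.ofReal B * E₁ := hlow.trans h1
      _ = E₁ * ENNReal.ofReal B := mul_comm _ _
  exact (ENNReal.mul_le_mul_iff_left ((ENNReal.ofReal_pos.2 hB0).ne') ENNReal.ofReal_ne_top).1 h2

/-- **Infinite energy forces a positive exponential `L¹` rate of the modes** (from
`exists_energyRate_of_energy_eq_top` and `L1Rate_of_energyRate`). [folklore] -/
theorem exists_L1Rate_of_energy_eq_top
    {v₀ : EuclideanSpace ℝ (Fin 3) → EuclideanSpace ℝ (Fin 3)}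
    {a R M₀ : ℝ} (ha : 0 < a) (hv₀m : Measurable v₀) (hv₀ : ∀ k, v₀ k ≠ 0 → a ≤ k 2 ∧ ‖k‖ ≤ R)
    (hM₀ : ∀ k, ‖v₀ k‖ ≤ M₀)
    {t : ℝ} (ht : 0 ≤ t) (hinf : ∫⁻ k, ‖seriesSolution v₀ t k‖ₑ ^ 2 = ∞) :
    ∃ L : ℝ, 0 < L ∧
      ∃ᶠ n : ℕ in atTop, ENNReal.ofReal (L ^ n) ≤ ∫⁻ k, ‖mode v₀ n t k‖ₑ := by
  obtain ⟨L, hL, hfreq⟩ := exists_energyRate_of_energy_eq_top ha hv₀m hv₀ hM₀ ht hinf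
  have hM₀' : 0 ≤ M₀ := (norm_nonneg _).trans (hM₀ 0)
  have hK₁ : 0 < (M₀ + 1) * max (4 * (M₀ * ballVol R) / a) 1 := by
    have : (1 : ℝ) ≤ max (4 * (M₀ * ballVol R) / a) 1 := le_max_right _ _
    positivity
  refine ⟨L / ((M₀ + 1) * max (4 * (M₀ * ballVol R) / a) 1), div_pos hL hK₁, ?_⟩
  exact (hfreq.and_eventually (eventually_ge_atTop 1)).mono fun n hn =>
    L1Rate_of_energyRate ha hv₀m hv₀ hM₀ ht hL hn.2 hn.1

end LiSinai

/-- **`L¹`-rate criterion for the core fact.** If ONE admissible datum `v₀` (measurable,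
bounded, vanishing off `{a ≤ k₃, |k| ≤ R}` with `a > 0`, incompressible) has, at one time
`t > 0` and for one `L > 0`, `Lⁿ ≤ ∫ ‖mode v₀ n (t,k)‖ dk` for infinitely many `n`, then
`LiSinaiSeriesEnergyInfinite` holds (`LiSinai.energyRate_of_L1Rate` and
`LiSinaiSeriesEnergyInfinite.of_modeEnergyRate`). [cite: LiSinai2008, §10 p. 312 (first
paragraph) and Thm. 1 p. 311] -/
theorem LiSinaiSeriesEnergyInfinite.of_modeL1Rate
    (h : ∃ (v₀ : EuclideanSpace ℝ (Fin 3) → EuclideanSpace ℝ (Fin 3)) (a R t L : ℝ),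
      0 < a ∧ 0 < t ∧ 0 < L ∧
      Measurable v₀ ∧ (∃ M : ℝ, ∀ k, ‖v₀ k‖ ≤ M) ∧ (∀ k, v₀ k ≠ 0 → a ≤ k 2 ∧ ‖k‖ ≤ R) ∧
      (∀ k, ⟪v₀ k, k⟫ = 0) ∧
      ∃ᶠ n : ℕ in atTop, ENNReal.ofReal (L ^ n) ≤ ∫⁻ k, ‖mode v₀ n t k‖ₑ) :
    LiSinaiSeriesEnergyInfinite := by
  obtain ⟨v₀, a, R, t, L, ha, ht, hL, hm, hM, hsupp, hdiv, hfreq⟩ := h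
  have hb : 0 < 8 * (|R| ^ 3 * ballVol 1 + 1) := by have := ballVol_nonneg 1; positivity
  refine LiSinaiSeriesEnergyInfinite.of_modeEnergyRate
    ⟨v₀, a, R, t, L ^ 2 / (8 * (|R| ^ 3 * ballVol 1 + 1)), ha, ht, div_pos (pow_pos hL 2) hb, hm,
      hM, hsupp, hdiv, ?_⟩
  exact (hfreq.and_eventually (eventually_ge_atTop 1)).mono fun n hn =>
    energyRate_of_L1Rate hm hsupp t hL hn.2 hn.1

/-- **A witness of the core fact has a positive `L¹` rate** (same datum and time;
`LiSinai.exists_L1Rate_of_energy_eq_top`). [folklore] -/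
theorem LiSinaiSeriesEnergyInfinite.exists_modeL1Rate (h : LiSinaiSeriesEnergyInfinite) :
    ∃ (v₀ : EuclideanSpace ℝ (Fin 3) → EuclideanSpace ℝ (Fin 3)) (a R t L : ℝ),
      0 < a ∧ 0 < t ∧ 0 < L ∧
      Measurable v₀ ∧ (∃ M : ℝ, ∀ k, ‖v₀ k‖ ≤ M) ∧ (∀ k, v₀ k ≠ 0 → a ≤ k 2 ∧ ‖k‖ ≤ R) ∧
      (∀ k, ⟪v₀ k, k⟫ = 0) ∧
      ∃ᶠ n : ℕ in atTop, ENNReal.ofReal (L ^ n) ≤ ∫⁻ k, ‖mode v₀ n t k‖ₑ := by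
  obtain ⟨v₀, a, R, t, ha, ht, hm, ⟨M₀, hM₀⟩, hsupp, hdiv, hinf⟩ := h
  obtain ⟨L, hL, hfreq⟩ := exists_L1Rate_of_energy_eq_top ha hm hsupp hM₀ ht.le hinf
  exact ⟨v₀, a, R, t, L, ha, ht, hL, hm, ⟨M₀, hM₀⟩, hsupp, hdiv, hfreq⟩

/-- **`L¹`-rate characterisation of the core fact.** `LiSinaiSeriesEnergyInfinite` holds if and
only if for one admissible datum `v₀`, one time `t > 0` and one `L > 0` the terms of Li–Sinai's
power series satisfy `Lⁿ ≤ ∫ ‖mode v₀ n (t,k)‖ dk` for infinitely many `n` — the `L¹` norms of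
the Duhamel–Taylor coefficients of the explicit all-time solution are not super-exponentially
small at some positive time. Companion of `LiSinaiSeriesEnergyInfinite_iff_modeEnergyRate`; what
Theorem 1 of the source (p. 311) is used for in §10 (p. 312). [cite: LiSinai2008, Thm. 1 p. 311
and §10 p. 312 (first paragraph)] -/
theorem LiSinaiSeriesEnergyInfinite_iff_modeL1Rate :
    LiSinaiSeriesEnergyInfinite ↔
      ∃ (v₀ : EuclideanSpace ℝ (Fin 3) → EuclideanSpace ℝ (Fin 3)) (a R t L : ℝ),
        0 < a ∧ 0 < t ∧ 0 < L ∧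
        Measurable v₀ ∧ (∃ M : ℝ, ∀ k, ‖v₀ k‖ ≤ M) ∧ (∀ k, v₀ k ≠ 0 → a ≤ k 2 ∧ ‖k‖ ≤ R) ∧
        (∀ k, ⟪v₀ k, k⟫ = 0) ∧
        ∃ᶠ n : ℕ in atTop, ENNReal.ofReal (L ^ n) ≤ ∫⁻ k, ‖mode v₀ n t k‖ₑ :=
  ⟨LiSinaiSeriesEnergyInfinite.exists_modeL1Rate, LiSinaiSeriesEnergyInfinite.of_modeL1Rate⟩

end Literature.Barriers.NavierStokesRegularity
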